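/-
Copyright: internal research formalization. Source texts: W. Fulton, Introduction to Toric Varieties
(Princeton UP 1993) [Fulton1993Toric], §1.2 pp. 9–14 (faces of polyhedral cones; minimal
generators of a strongly convex cone are unique up to positive scalars), §2.1 p. 29, §2.6 p. 48;
G. Ewald, Combinatorial Convexity and Algebraic Geometry (GTM 168, 1996) [Ewald1996], V §1–§2.
-/
import Mathlib
import HarnessLib
import Literature.Geometry.PolyhedralFans.SimplicialRefinement
import Literature.Geometry.PolyhedralFans.LatticePoints

/-!
# Generators of simplicial cones: faces are sub-hulls, primitive generators are unique

Topic: `Literature/Geometry/PolyhedralFans`; bookkeeping lemmas for the regular-refinement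
theorem ([KempfEtAl1973] Ch. I Thm. 11; [Fulton1993Toric] §2.6; [Ewald1996] VI Thm. 8.5).

## Content (all PROVED; no named facts)

* `mem_hull_finset_iff` — membership in the hull of a finite set as a nonnegative combination;
* `eq_hull_filter_of_isFaceOf_hull` — **a face of the hull of a finite set `S` is the hull of the
  elements of `S` it contains** ([Fulton1993Toric] §1.2 (2)–(5) p. 10: faces are generated by
  the generators they contain);
* `hull_eq_hull_of_forall_ray_eq` — rescaling generators by positive scalars does not change the
  hull; `exists_primitive_generators` — a rational cone is the hull of finitely many PRIMITIVE
  lattice vectors;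
* `eq_of_hull_eq_hull` — **two linearly independent families of primitive lattice vectors with
  the same hull coincide** ([Fulton1993Toric] §1.2 p. 14: "these minimal generators are unique up
  to multiplication by positive scalars", together with the normalisation "first lattice points
  along the edges", §2.6 p. 48);
* `IsFaceOf.filter_eq_of_hull` — consequently a face of a cone with primitive linearly independent
  generators `S` that is itself such a cone with generators `T` has `T = S ∩ face`.

## Not here

Fans (next file `RegularRefinement`).
-/

noncomputable section

namespace Literature.Geometry.PolyhedralFans

open PointedCone Finset

section General

variable {𝕜 : Type*} [Field 𝕜] [LinearOrder 𝕜] [IsStrictOrderedRing 𝕜]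
variable {V : Type*} [AddCommGroup V] [Module 𝕜 V]

/-- Membership in the hull of a finite set: a combination with nonnegative coefficients
([Fulton1993Toric] §1.2 p. 9, "`σ = {r₁v₁ + … + r_s v_s : rᵢ ≥ 0}`"). [cite: Fulton1993Toric, §1.2 p. 9] -/
theorem mem_hull_finset_iff {S : Finset V} {x : V} :
    x ∈ PointedCone.hull 𝕜 (S : Set V) ↔
      ∃ c : V → 𝕜, (∀ s ∈ S, 0 ≤ c s) ∧ ∑ s ∈ S, c s • s = x := by
  rw [PointedCone.hull, Submodule.mem_span_finset]
  constructor
  · rintro ⟨f, -, hf⟩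
    refine ⟨fun s => (f s : 𝕜), fun s _ => (f s).2, ?_⟩
    rw [← hf]
    exact Finset.sum_congr rfl fun s _ => by rw [Nonneg.coe_smul]
  · rintro ⟨c, hc, rfl⟩
    classical
    refine ⟨fun s => if h : s ∈ S then ⟨c s, hc s h⟩ else 0, ?_, ?_⟩
    · intro s hs
      rw [Function.mem_support] at hs
      by_contra h
      have h' : s ∉ S := fun h'' => h (Finset.mem_coe.mpr h'')
      exact hs (by simp only [dif_neg h'])
    · refine Finset.sum_congr rfl fun s hs => ?_
      simp only [dif_pos hs, Nonneg.mk_smul]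

/-- A nonnegative combination of elements of `S` lies in the hull of `S`.
[cite: Fulton1993Toric, §1.2 p. 9] -/
theorem sum_smul_mem_hull {S : Finset V} {c : V → 𝕜} (hc : ∀ s ∈ S, 0 ≤ c s) :
    ∑ s ∈ S, c s • s ∈ PointedCone.hull 𝕜 (S : Set V) :=
  mem_hull_finset_iff.mpr ⟨c, hc, rfl⟩

/-- **A face of the hull of a finite set is the hull of the generators it contains**
([Fulton1993Toric] §1.2 p. 10: a face `σ ∩ u^⊥` "is generated by those vectors `vᵢ` in a
generating set for `σ` such that `⟨u, vᵢ⟩ = 0`"). [cite: Fulton1993Toric, §1.2 (2) p. 10] -/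
theorem eq_hull_filter_of_isFaceOf_hull [DecidableEq V] {S : Finset V} {F : PointedCone 𝕜 V}
    (hF : F.IsFaceOf (PointedCone.hull 𝕜 (S : Set V))) [DecidablePred (· ∈ F)] :
    F = PointedCone.hull 𝕜 ((S.filter (· ∈ F) : Finset V) : Set V) := by
  apply le_antisymm
  · intro x hxF
    obtain ⟨c, hc, hcx⟩ := mem_hull_finset_iff.mp (hF.le hxF)
    -- generators with positive coefficient lie in `F`
    have hmem : ∀ s ∈ S, 0 < c s → s ∈ F := by
      intro s hs hcs
      have hsum : ∑ i : S, c i • (i : V) ∈ F := by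
        rw [Finset.sum_coe_sort S (fun s => c s • s), hcx]; exact hxF
      exact hF.mem_of_sum_smul_mem (f := fun i : S => (i : V)) (c := fun i => c i)
        (fun i => PointedCone.subset_hull (Finset.mem_coe.mpr i.2)) (fun i => hc i i.2) hsum
        ⟨s, hs⟩ hcs
    rw [← hcx, ← Finset.sum_filter_add_sum_filter_not S (· ∈ F) (fun s => c s • s)]
    have hzero : ∑ s ∈ S.filter (fun s => ¬ s ∈ F), c s • s = 0 := by
      refine Finset.sum_eq_zero fun s hs => ?_
      obtain ⟨hsS, hsF⟩ := Finset.mem_filter.mp hs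
      rcases (hc s hsS).lt_or_eq with h | h
      · exact absurd (hmem s hsS h) hsF
      · rw [← h, zero_smul]
    rw [hzero, add_zero]
    exact sum_smul_mem_hull fun s hs => hc s (Finset.mem_filter.mp hs).1
  · rw [PointedCone.hull, Submodule.span_le]
    intro s hs
    exact (Finset.mem_filter.mp hs).2

/-- The hull of a finite set is the supremum of the rays through its elements.
[cite: Fulton1993Toric, §1.2 p. 9] -/
theorem hull_eq_iSup_ray (S : Set V) : PointedCone.hull 𝕜 S = ⨆ s ∈ S, ray 𝕜 s := by
  rw [PointedCone.hull, Submodule.span_eq_iSup_of_singleton_spans]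

/-- Rescaling the generators by positive scalars does not change the hull.
[cite: Fulton1993Toric, §1.2 p. 14] -/
theorem hull_image_smul_eq (S : Finset V) (c : V → 𝕜) (hc : ∀ s ∈ S, 0 < c s) [DecidableEq V] :
    PointedCone.hull 𝕜 ((S.image fun s => c s • s : Finset V) : Set V) =
      PointedCone.hull 𝕜 (S : Set V) := by
  rw [hull_eq_iSup_ray, hull_eq_iSup_ray]
  apply le_antisymm
  · refine iSup₂_le fun x hx => ?_
    obtain ⟨s, hs, rfl⟩ := Finset.mem_image.mp (Finset.mem_coe.mp hx)
    rw [ray_smul_eq (hc s hs)]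
    exact le_iSup₂ (f := fun s _ => ray 𝕜 s) s (Finset.mem_coe.mpr hs)
  · refine iSup₂_le fun s hs => ?_
    rw [← ray_smul_eq (hc s hs)]
    exact le_iSup₂ (f := fun x _ => ray 𝕜 x) (c s • s)
      (Finset.mem_coe.mpr (Finset.mem_image.mpr ⟨s, hs, rfl⟩))

end General

/-! ## Primitive generators (lattice `ℤ^κ ⊆ ℚ^κ`) -/

section Lattice

variable {κ : Type*}

/-- **A rational cone is the hull of finitely many primitive lattice vectors**: replace each
nonzero lattice generator by the first lattice point on its ray.
[cite: Fulton1993Toric, §2.6 p. 48] -/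
theorem exists_primitive_generators [DecidableEq κ] {S : Finset (κ → ℚ)}
    (hS : ∀ s ∈ S, s ∈ latticeN κ) :
    ∃ P : Finset (κ → ℚ), (∀ p ∈ P, IsPrimitive p) ∧ (∀ p ∈ P, ∃ s ∈ S, ∃ c : ℚ, 0 < c ∧ p = c • s)
      ∧ PointedCone.hull ℚ (P : Set (κ → ℚ)) = PointedCone.hull ℚ (S : Set (κ → ℚ)) := by
  classical
  -- remove `0`, then rescale
  let S₀ := S.erase 0
  have hS₀ : ∀ s ∈ S₀, s ∈ latticeN κ ∧ s ≠ 0 := fun s hs =>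
    ⟨hS s (Finset.mem_of_mem_erase hs), Finset.ne_of_mem_erase hs⟩
  have hc : ∀ s : κ → ℚ, ∃ c : ℚ, s ∈ S₀ → 0 < c ∧ c ≤ 1 ∧ IsPrimitive (c • s) := by
    intro s
    by_cases hs : s ∈ S₀
    · obtain ⟨c, hc0, hc1, hp⟩ := exists_isPrimitive_smul (hS₀ s hs).1 (hS₀ s hs).2
      exact ⟨c, fun _ => ⟨hc0, hc1, hp⟩⟩
    · exact ⟨1, fun h => absurd h hs⟩
  choose c hc using hc
  refine ⟨S₀.image fun s => c s • s, ?_, ?_, ?_⟩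
  · intro p hp
    obtain ⟨s, hs, rfl⟩ := Finset.mem_image.mp hp
    exact (hc s hs).2.2
  · intro p hp
    obtain ⟨s, hs, rfl⟩ := Finset.mem_image.mp hp
    exact ⟨s, Finset.mem_of_mem_erase hs, c s, (hc s hs).1, rfl⟩
  · rw [hull_image_smul_eq S₀ c fun s hs => (hc s hs).1, Finset.coe_erase, PointedCone.hull,
      PointedCone.hull, Submodule.span_sdiff_singleton_zero]

/-- **Linearly independent primitive generators of a cone are unique** (one inclusion): if a
linearly independent finite family `S` of primitive lattice vectors and a finite family `S'` of
primitive lattice vectors have the same hull, then `S ⊆ S'` ([Fulton1993Toric] §1.2 p. 14: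
minimal generators of a strongly convex cone "are unique up to multiplication by positive
scalars"; normalised to first lattice points, §2.6 p. 48). [cite: Fulton1993Toric, §1.2 p. 14] -/
theorem subset_of_hull_eq_hull {S S' : Finset (κ → ℚ)} (hS : ∀ s ∈ S, IsPrimitive s)
    (hli : LinearIndepOn ℚ id (S : Set (κ → ℚ))) (hS' : ∀ s ∈ S', IsPrimitive s)
    (h : PointedCone.hull ℚ (S : Set (κ → ℚ)) = PointedCone.hull ℚ (S' : Set (κ → ℚ))) :
    S ⊆ S' := by
  classical
  intro s hs
  -- `s = Σ_{t ∈ S'} c_t t`, and each `t ∈ S'` is `Σ_{u ∈ S} d_t(u) u`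
  have hsS' : s ∈ PointedCone.hull ℚ (S' : Set (κ → ℚ)) := h ▸ PointedCone.subset_hull hs
  obtain ⟨c, hc, hcs⟩ := mem_hull_finset_iff.mp hsS'
  have hd : ∀ t : κ → ℚ, ∃ d : (κ → ℚ) → ℚ, t ∈ S' → (∀ u ∈ S, 0 ≤ d u) ∧ ∑ u ∈ S, d u • u = t := by
    intro t
    by_cases ht : t ∈ S'
    · have htS : t ∈ PointedCone.hull ℚ (S : Set (κ → ℚ)) := h.symm ▸ PointedCone.subset_hull ht
      obtain ⟨d, hd, hdt⟩ := mem_hull_finset_iff.mp htS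
      exact ⟨d, fun _ => ⟨hd, hdt⟩⟩
    · exact ⟨0, fun h' => absurd h' ht⟩
  choose d hd using hd
  let e : (κ → ℚ) → ℚ := fun u => ∑ t ∈ S', c t * d t u
  have hA : ∑ u ∈ S, e u • u = s := by
    calc ∑ u ∈ S, e u • u = ∑ u ∈ S, ∑ t ∈ S', (c t * d t u) • u := by
          refine Finset.sum_congr rfl fun u _ => ?_
          rw [Finset.sum_smul]
      _ = ∑ t ∈ S', ∑ u ∈ S, (c t * d t u) • u := Finset.sum_comm
      _ = ∑ t ∈ S', c t • ∑ u ∈ S, d t u • u := by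
          refine Finset.sum_congr rfl fun t _ => ?_
          rw [Finset.smul_sum]
          refine Finset.sum_congr rfl fun u _ => ?_
          rw [mul_smul]
      _ = ∑ t ∈ S', c t • t := by
          refine Finset.sum_congr rfl fun t ht => ?_
          rw [(hd t ht).2]
      _ = s := hcs
  have hB : ∑ u ∈ S, (if u = s then (1 : ℚ) else 0) • u = s := by
    simp only [ite_smul, one_smul, zero_smul, Finset.sum_ite_eq', if_pos hs]
  have he : ∀ u ∈ S, e u = if u = s then 1 else 0 :=
    eq_on_of_sum_smul_eq hli (hA.trans hB.symm)
  -- some `c_{t₀} > 0`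
  obtain ⟨t₀, ht₀, hct₀⟩ : ∃ t ∈ S', 0 < c t := by
    by_contra hne
    push Not at hne
    have : ∑ t ∈ S', c t • t = 0 := Finset.sum_eq_zero fun t ht => by
      rw [le_antisymm (hne t ht) (hc t ht), zero_smul]
    exact (hS s hs).2.1 (hcs.symm.trans this)
  -- `d_{t₀}` vanishes off `s`
  have hd0 : ∀ u ∈ S, u ≠ s → d t₀ u = 0 := by
    intro u hu hus
    have h0 : e u = 0 := by rw [he u hu, if_neg hus]
    have hterm := (Finset.sum_eq_zero_iff_of_nonneg (fun t ht =>
      mul_nonneg (hc t ht) ((hd t ht).1 u hu))).mp h0 t₀ ht₀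
    rcases mul_eq_zero.mp hterm with h1 | h1
    · exact absurd h1 hct₀.ne'
    · exact h1
  have ht₀eq : t₀ = d t₀ s • s := by
    have h1 : ∑ u ∈ S, d t₀ u • u = d t₀ s • s :=
      Finset.sum_eq_single s (fun u hu hus => by rw [hd0 u hu hus, zero_smul])
        (fun h' => absurd hs h')
    rw [← h1, (hd t₀ ht₀).2]
  have hdpos : 0 < d t₀ s := by
    rcases ((hd t₀ ht₀).1 s hs).lt_or_eq with h1 | h1
    · exact h1
    · exfalso; rw [← h1, zero_smul] at ht₀eq; exact (hS' t₀ ht₀).2.1 ht₀eq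
  have hst₀ : s = t₀ := (hS s hs).eq_of_eq_smul (hS' t₀ ht₀) hdpos ht₀eq
  rw [hst₀]; exact ht₀

/-- **Linearly independent primitive generators of a cone are unique.**
[cite: Fulton1993Toric, §1.2 p. 14] -/
theorem eq_of_hull_eq_hull {S S' : Finset (κ → ℚ)} (hS : ∀ s ∈ S, IsPrimitive s)
    (hli : LinearIndepOn ℚ id (S : Set (κ → ℚ))) (hS' : ∀ s ∈ S', IsPrimitive s)
    (hli' : LinearIndepOn ℚ id (S' : Set (κ → ℚ)))
    (h : PointedCone.hull ℚ (S : Set (κ → ℚ)) = PointedCone.hull ℚ (S' : Set (κ → ℚ))) :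
    S = S' :=
  Finset.Subset.antisymm (subset_of_hull_eq_hull hS hli hS' h)
    (subset_of_hull_eq_hull hS' hli' hS h.symm)

/-- **The generators of a face are the generators it contains**: if the hull of a linearly
independent primitive family `T` is a face of the hull of a primitive family `S`, then
`T = {s ∈ S | s ∈ face}`; in particular `T ⊆ S`. [cite: Fulton1993Toric, §1.2 (2) p. 10] -/
theorem eq_filter_of_isFaceOf {S T : Finset (κ → ℚ)} (hS : ∀ s ∈ S, IsPrimitive s)
    (hli : LinearIndepOn ℚ id (S : Set (κ → ℚ))) (hT : ∀ t ∈ T, IsPrimitive t)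
    (hliT : LinearIndepOn ℚ id (T : Set (κ → ℚ)))
    (hF : (PointedCone.hull ℚ (T : Set (κ → ℚ))).IsFaceOf (PointedCone.hull ℚ (S : Set (κ → ℚ))))
    [DecidablePred (· ∈ PointedCone.hull ℚ (T : Set (κ → ℚ)))] :
    T = S.filter (· ∈ PointedCone.hull ℚ (T : Set (κ → ℚ))) := by
  classical
  have hF' := eq_hull_filter_of_isFaceOf_hull hF
  refine eq_of_hull_eq_hull hT hliT (fun s hs => hS s (Finset.mem_filter.mp hs).1)
    (hli.mono (by intro x hx; exact (Finset.mem_filter.mp (Finset.mem_coe.mp hx)).1)) ?_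
  convert hF' using 2

end Lattice

end Literature.Geometry.PolyhedralFans

end
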